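import Summits.ResolutionOfSingularities.ResolutionOfSingularities.Theorems.HeightTowers
import HarnessLib

/-!
# HeightCutCells — decomp-res node «HeightCut» (lens-4 g25, critic row 151), tree file 3/4 of the node

Content VERBATIM from the decomp-res lens-4 g25 node `HOME/decomp-res-lens-4/g25/HeightCut.lean` (pin 3caeb106, 1
322 l; HOME = run/shared/lean/pub/decomp-res):
its NEW PART ONLY, l. 815–1320 (§64, §64b, §65; 26 declarations) — the carried block l. 79–811 (= row
148a's landing unit `KangarooCutTree` 76e53063,
machine diff empty) is ALREADY in the tree as `Theorems/PPowerSpan` · `KangarooTransport` · `KangarooTowers` ·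
`KangarooCutCells` · `MaxContactCutKangarooCut`
and is DELETED ON LANDING as the lens instructs.  Critic: CRITIC-LEDGER row 151 (CLEARED 2026-08-30T22:50:05Z,
DECIDED +1 (i*) at p = 2 = n: the WEIGHT-TWO
HEIGHT LAW in kernel empties the principal double-point/dim-4 cell; exact re-location to
`NoWildKangarooOffDoublePointTowers`); landing orders INBOX :442/:444
(lens-4 g25) and :463 (critic): `HeightLaw` (§64) · `HeightTowers` (§64b) · `HeightCutCells` (§65), `--supports
stmt-ResolutionOfSingularities-28338`.  Landed by
decomp-res writer g8 in the lens's namespace `…Theorems.HugValuationCut`, CONE-AWARE: `HeightLaw`, `HeightTowers`,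
`HeightCutCells` are OUTSIDE the Theses
cone (importable by the route file); the two §65 up-links from the MaxContactCut item 31571
(`noWildPPowerOffLocusTowers_iff_g25 (h71)`,
`noWildContactFreeOffLocusTowers_iff_g25 (h71)`) are the in-cone wiring file `MaxContactCutHeightCut`.  Aside
bookkeeping (critic rows 148/151): the ONE
successor aside of the kangaroo column is filed directly as `NoWildKangarooOffDoublePointTowers` (home
`HeightCutCells`) SUPERSEDING 28338
`LCNoWildContactFreeOffLocusTowers` — exactness chain `noWildContactFreeOffLocusTowers_iff_pPower` (tree, every
field) ∘ `noWildPPowerOffLocusTowers_iff_kangaroo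
(h31571)` (tree, `MaxContactCutKangarooCut`) ∘ `noWildKangarooOffLocusTowers_iff_g25` (this node, hypothesis-free)
= `noWildContactFreeOffLocusTowers_iff_g25 (h71)`;
the decided cell `NoWildKangarooDoublePointTowers` is PROVED (`noWildKangarooDoublePointTowers_holds`) and is not filed.

§65 (l. 1226–1319), CONE-FREE PART: the cells `WildKangarooDoublePointTowersTerminate` (DECIDED:
`wildKangarooDoublePoint_holds`,
`noWildKangarooDoublePointTowers_holds`) / `WildKangarooOffDoublePointTowersTerminate` (THE LOCATED RESIDUAL after g25), BY NAME
`NoWildKangarooDoublePointTowers` / **`NoWildKangarooOffDoublePointTowers`** (= the successor aside's statement),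
the exact split and re-locations
`wildKangarooOffLocus_split`, `wildKangarooOffLocus_iff_g25`, `noWildKangarooOffLocusTowers_iff_g25`,
`noWildKangarooOffLocusTowers_of_g25`, and the
class-independent cut `noTowerWild_two_doublePointTower`.  Imports `HeightTowers`.  Cone-free (the two 31571
up-links are in `MaxContactCutHeightCut`).

[WRITER NOTE (decomp-res writer g8): section split only; namespace, universes, section variables and every
declaration exactly as in the lens
(global `set_option` dropped; the lens's cone import `MaxContactCutTameCut` is replaced in the cone-free files by
the landed cone-free chain under
`KangarooCutCells` — `AbsoluteGiraudKernel` (`AbsoluteContactClasses.isRsopPart_one_of_not_mem_sq`,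
`point_round_chart`), `…CentreSpread` (`centreSpread`),
`PPowerTowers`, `TameCutStage`, `LatencyCutCells`; the `open …Theses` line lives only in the wiring file).]

(Sources: Hauser2010Kangaroo; Moh1987; HauserPerlega2019; Hironaka1970Additive; CossartPiltant2008 §2;
CossartPiltant2019 Prop. 2.50; Kollar2007 Rem. 2.61.2; EGA IV₄ 16.11.2; StacksProject.)
-/

noncomputable section

open CategoryTheory AlgebraicGeometry IsLocalRing
open Literature.AlgebraicGeometry.Resolution
open Summit.ResolutionOfSingularities.ResolutionOfSingularities.Theorems
open WeakOrderReduction ForcedTowerClasses DivergentTowerClasses MonomialTowerClasses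
open HugDimensionClasses HugDimensionKernels SurfaceShadowClasses SurfaceShadowKernels
open NearPointCut (SingularClass)
open AbsoluteContactClasses (IsAbsContactAt SepResidueAt diffIdeal_restrict_le stalkMap_comp_toStalk_eq_stalkHom)
open scoped BigOperators

namespace Summit.ResolutionOfSingularities.ResolutionOfSingularities.Theorems.HugValuationCut

/-! ## §65 (g25 · CELLS) THE HEIGHT CUT of the kangaroo residual — EXACT, hypothesis-free

`WildKangarooOffLocusTowersTerminate n` (g24's located residual: singular-class, marked-shadow, `p`-power, NOT eventually
jump-free) splits by pure logic along `n = 2 ∧ DoublePointTower T`: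
* `WildKangarooDoublePointTowersTerminate n` — DECIDED: PROVED for every `n` (`no_doublePointTower`; EMPTY BY THE HEIGHT LAW);
* `WildKangarooOffDoublePointTowersTerminate n` — THE LOCATED RESIDUAL after g25: recurrent `p`-power kangaroo
towers which, IF
  `n = 2`, never pass from a double point (principal mod `𝔪⁴`, weak contact) to a dim-4 point — over a
perfect field at weight
  two: every stage with principal stalk is followed by a point of ring dimension ≤ 3 (`doublePointAt_stage_of_pPowerFormAt`),
  i.e. the weight-two tower is CONFINED TO THREEFOLD GERMS from its first principal stage on, or has non-principal stalks; and
  every weight `n ≥ 3` tower (the law is sharp there, §64 DELIMITERS).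
By name: `NoWildKangarooOffLocusTowers ↔ NoWildKangarooOffDoublePointTowers` (`noWildKangarooOffLocusTowers_iff_g25`). -/

section HeightCells

variable {k : Type} [Field k]

/-- **DECIDED CELL (PROVED EMPTY): recurrent `p`-power kangaroo towers OF WEIGHT TWO THROUGH A DOUBLE POINT WITH A DIM-4
SUCCESSOR terminate** — vacuously-by-theorem: no forced tower of weight two has such a stage (`no_doublePointTower`).
 -/
def WildKangarooDoublePointTowersTerminate (n : ℕ) : Prop :=
  NoTowerWild n fun T =>
    (((SingularClass T ∧ Nonempty (MarkedShadow T n)) ∧ PPowerTower n T) ∧ ¬ EventuallyJumpFree n T) ∧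
      (n = 2 ∧ DoublePointTower T)

/-- **THE LOCATED RESIDUAL after g25: recurrent `p`-power kangaroo towers OFF THE DOUBLE-POINT/DIM-4 CELL terminate** — at
weight two: towers that never pass from a weak-contact double point (principal mod `𝔪⁴`) to a point of ring
dimension ≥ 4;
every weight `n ≠ 2`. (leaf: IDEA-NEEDED — the weight-`p ≥ 3` dim-4 finiteness law / the threefold-germ
weight-two towers.)
(Sources: Hauser2010Kangaroo; Moh1987; HauserPerlega2019.) -/
def WildKangarooOffDoublePointTowersTerminate (n : ℕ) : Prop :=
  NoTowerWild n fun T =>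
    (((SingularClass T ∧ Nonempty (MarkedShadow T n)) ∧ PPowerTower n T) ∧ ¬ EventuallyJumpFree n T) ∧
      ¬ (n = 2 ∧ DoublePointTower T)

/-- by name, all weights. -/
def NoWildKangarooDoublePointTowers : Prop := ∀ n : ℕ, 1 ≤ n → WildKangarooDoublePointTowersTerminate n

/-- **THE LOCATED RESIDUAL OF THE CELL after g25, by name.** -/
def NoWildKangarooOffDoublePointTowers : Prop := ∀ n : ℕ, 1 ≤ n → WildKangarooOffDoublePointTowersTerminate n

/-- **EXACT SPLIT (pure logic)**: g24's kangaroo residual ⟺ (double-point/dim-4 cell) ∧ (off cell). [folklore] -/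
theorem wildKangarooOffLocus_split (n : ℕ) :
    WildKangarooOffLocusTowersTerminate n ↔
      WildKangarooDoublePointTowersTerminate n ∧ WildKangarooOffDoublePointTowersTerminate n :=
  noTowerWild_split _ _

/-- **DECIDED (KERNEL, PROVED, every `n`, every field): THE DOUBLE-POINT/DIM-4 CELL IS EMPTY** — `n = 2` forces `IsDatum 2`,
and `no_doublePointTower` applies. [folklore] -/
theorem wildKangarooDoublePoint_holds (n : ℕ) : WildKangarooDoublePointTowersTerminate n := by
  intro p hp hpn k _ _ T g hB hD hb hA
  obtain ⟨-, hn2, hT⟩ := hA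
  subst hn2
  exact no_doublePointTower T g hB hD hT

/-- by name: the decided cell holds at every weight. [folklore] -/
theorem noWildKangarooDoublePointTowers_holds : NoWildKangarooDoublePointTowers := fun n _ =>
  wildKangarooDoublePoint_holds n

/-- **EXACT RE-LOCATION at weight `n` (hypothesis-free)**: g24's residual ⟺ the off-double-point residual. [folklore] -/
theorem wildKangarooOffLocus_iff_g25 (n : ℕ) :
    WildKangarooOffLocusTowersTerminate n ↔ WildKangarooOffDoublePointTowersTerminate n := by
  rw [wildKangarooOffLocus_split]
  exact ⟨fun h => h.2, fun h => ⟨wildKangarooDoublePoint_holds n, h⟩⟩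

/-- **EXACT RE-LOCATION BY NAME (hypothesis-free)**: `NoWildKangarooOffLocusTowers ↔
NoWildKangarooOffDoublePointTowers`. [folklore] -/
theorem noWildKangarooOffLocusTowers_iff_g25 : NoWildKangarooOffLocusTowers ↔ NoWildKangarooOffDoublePointTowers :=
  forall_congr' fun n => imp_congr_right fun _ => wildKangarooOffLocus_iff_g25 n

/-- up-link (hypothesis-free direction): the g25 residual ⟹ g24's residual ⟹ … (all the carried up-links
apply). [folklore] -/
theorem noWildKangarooOffLocusTowers_of_g25 (h : NoWildKangarooOffDoublePointTowers) : NoWildKangarooOffLocusTowers :=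
  noWildKangarooOffLocusTowers_iff_g25.mpr h

/-- **THE GENERAL FORM OF THE CUT (KERNEL, PROVED): EVERY forced-tower class at weight two is EMPTY on the double-point/dim-4
cell** — for any class predicate `A`, `NoTowerWild 2 (A ∧ DoublePointTower)`; so the same cut applies verbatim
to every other
lens's weight-two tower residual. [folklore] -/
theorem noTowerWild_two_doublePointTower (A : ForcedTower → Prop) :
    NoTowerWild 2 fun T => A T ∧ DoublePointTower T := by
  intro p hp hpn k _ _ T g hB hD hb hA
  exact no_doublePointTower T g hB hD hA.2

end HeightCells

end Summit.ResolutionOfSingularities.ResolutionOfSingularities.Theorems.HugValuationCut
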